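import Mathlib
import Literature.LinearAlgebra.Matrix.HermitianCfcComplexification
import Literature.MathematicalPhysics.QuantumFieldTheory.Balaban1983to89.B14LogDet336Matrix

/-!
# `Balaban1983to89.B14Eq334Contour` — T. Bałaban, *Convergent renormalization expansions for lattice gauge theories*,
# Commun. Math. Phys. **119** (1988) 243–285 [Balaban1988Convergent]: (3.34) p. 273, SECOND equality — the contour-integral
# representation `−½ Tr log(C*Δ^{(k)}C) = (1/(4πi)) ∫_γ dz log z Tr(C*Δ^{(k)}C − zI)⁻¹`, PROVED in every finite dimension
# for a contour `γ` = a circle in the right half-plane surrounding the spectrum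

statement-level skeleton of published theorems with citation tags; proofs where landed; nothing here is a claim about the Yang–Mills mass gap

PDF held: `paper:balaban1988-cmp119-convergent-renormalization` (journal page = PDF page + 242); display read on the x2
render `…-p031-x2.png` (p. 273) of `run/shared/lean/pub/pub-balaban/b2b-balaban-ref1/pages/1988-cmp119-…/`.

CITATION HEADER (lean-in-tree rule).  WHAT IS REPRODUCED, verbatim, p. 273 [PDF 31]: *"We have
− ½ log det(C\*Δ^{(k)}C) = − ½ Tr log(C\*Δ^{(k)}C) = (1/(4πi)) ∫_γ dz log z Tr(C\*Δ^{(k)}C − zI)⁻¹, (3.34)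
where the contour γ surrounds the spectrum of C\*Δ^{(k)}C, e.g. we take γ composed of a segment of the circle |z| = R
for R large enough, and of an interval on the line Re z = r, r positive and small."* — SKELETON row **B14.Eq3.33–3.36**,
the (3.34)₂ part.  The sibling module `…B14LogDet336Matrix` proves (3.34)₁ (`log det = Tr log`, `log_det_eq_trace_log`)
and the corrected (3.36) by a REAL-variable route and records (module docstring, "WHAT IS NOT REPRODUCED") that the
contour representation (3.34)₂ is not reproduced there; this file supplies it.

THE TYPED READING.  The positive operator `C*Δ^{(k)}C` is a positive definite real symmetric matrix `T` on a finite
index type `n` (the model of `…B14LogDet336Matrix`); `Tr(T − zI)⁻¹` for complex `z` is the trace of the inverse of the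
complexified matrix `T.map (algebraMap ℝ ℂ) − z•1`; the contour: the paper allows any contour surrounding the spectrum
inside the domain of `log z` ("e.g. we take …"); we take the circle `C(c, R)` with `0 < R < c` containing all
eigenvalues (every positive definite `T` admits one, `exists_circle`), on whose closed disc `log` is holomorphic — an
instance of the printed "γ surrounds the spectrum of C*Δ^{(k)}C" (the printed D-shaped contour is homologous to it in
`ℂ ∖ (−∞, 0]` minus the spectrum; that homology is NOT formalized, the circle is).

WHAT IS PROVED (kernel-checked, 0 sorry): `trace_inv_sub_smul_one` — for a complex Hermitian matrix `A` and `z` off its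
spectrum, `Tr(A − zI)⁻¹ = Σ_k (μ_k − z)⁻¹` (unitary diagonalization); `circleIntegral_finset_sum` — finite sums commute
with circle integrals; `circleIntegral_log_mul_inv_sub` — Cauchy's formula `∮_{C(c,R)} log z · (μ − z)⁻¹ dz = −2πi log μ`
for `μ` in the disc, `0 < R < c`; and the row theorems `eq334_contour` — `(1/(4πi)) ∮_{C(c,R)} log z · Tr(T_ℂ − zI)⁻¹ dz
= −½ log det T` — and `eq334_contour_trace_log` (`= −½ Tr log T`, chaining `B14LogDet336Matrix.log_det_eq_trace_log`).
NOT asserted: anything about the operators `C`, `Δ^{(k)}` or the bound `λ₀ > r` on the spectrum.  Mega-formalization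
`lit-balaban`, unit `lit-balaban-r11` gen 2 (upgrade of row B14.Eq3.33–3.36, sub-display (3.34)₂), HOME
`run/shared/lean/pub/lit-balaban/`.

## References
* [Balaban1988Convergent] T. Bałaban, Commun. Math. Phys. 119 (1988) 243–285, (3.34) p. 273.
-/

noncomputable section

open Complex MeasureTheory Matrix Finset Set
open scoped Real

namespace Literature.MathematicalPhysics.QuantumFieldTheory.Balaban1983to89.B14.Eq334Contour

open Literature.MathematicalPhysics.QuantumFieldTheory.Balaban1983to89
open Literature.LinearAlgebra.Matrix (isHermitian_map_ofReal sum_eigenvalues_map_ofReal)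

variable {n : Type*} [Fintype n] [DecidableEq n]

/-! ## §1. The resolvent trace of a Hermitian matrix -/

/-- `Tr(A − zI)⁻¹ = Σ_k (μ_k − z)⁻¹` for a complex Hermitian matrix `A` with eigenvalues `μ_k` and `z` off the spectrum
(unitary diagonalization `A = U diag(μ) U*`) — the meaning of "Tr(C*Δ^{(k)}C − zI)⁻¹" in (3.34).
[cite: Balaban1988Convergent, (3.34) p.273] -/
theorem trace_inv_sub_smul_one {A : Matrix n n ℂ} (hA : A.IsHermitian) (z : ℂ)
    (hz : ∀ k, (hA.eigenvalues k : ℂ) ≠ z) :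
    (A - z • (1 : Matrix n n ℂ))⁻¹.trace = ∑ k, ((hA.eigenvalues k : ℂ) - z)⁻¹ := by
  set U : Matrix n n ℂ := (hA.eigenvectorUnitary : Matrix n n ℂ) with hU
  have hUU : U * star U = 1 := Matrix.mem_unitaryGroup_iff.mp hA.eigenvectorUnitary.2
  have hUU' : star U * U = 1 := Matrix.mem_unitaryGroup_iff'.mp hA.eigenvectorUnitary.2
  set d : n → ℂ := fun k => (hA.eigenvalues k : ℂ) with hd
  have hdiag : (diagonal (RCLike.ofReal ∘ hA.eigenvalues) : Matrix n n ℂ) = diagonal d := by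
    congr 1
  have hspec : A = U * diagonal d * star U := by
    have h := hA.spectral_theorem
    rw [Unitary.conjStarAlgAut_apply, hdiag] at h
    exact h
  -- `A − zI = U (diag d − zI) U*`
  have hsub : A - z • (1 : Matrix n n ℂ) = U * diagonal (fun k => d k - z) * star U := by
    rw [hspec]
    have : diagonal (fun k => d k - z) = diagonal d - z • (1 : Matrix n n ℂ) := by
      rw [smul_one_eq_diagonal, diagonal_sub]
    rw [this, Matrix.mul_sub, Matrix.sub_mul, Matrix.mul_smul, Matrix.mul_one, Matrix.smul_mul, hUU]
  -- the inverse
  have hne : ∀ k, d k - z ≠ 0 := fun k => sub_ne_zero.mpr (hz k)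
  have hinv : (A - z • (1 : Matrix n n ℂ))⁻¹ = U * diagonal (fun k => (d k - z)⁻¹) * star U := by
    apply Matrix.inv_eq_right_inv
    rw [hsub]
    calc U * diagonal (fun k => d k - z) * star U * (U * diagonal (fun k => (d k - z)⁻¹) * star U)
        = U * (diagonal (fun k => d k - z) * (star U * U) * diagonal (fun k => (d k - z)⁻¹)) * star U := by
          simp only [Matrix.mul_assoc]
      _ = U * star U := by
          rw [hUU', Matrix.mul_one, diagonal_mul_diagonal]
          have : (fun k => (d k - z) * (d k - z)⁻¹) = fun _ => (1 : ℂ) := by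
            funext k; exact mul_inv_cancel₀ (hne k)
          rw [this, diagonal_one, Matrix.mul_one]
      _ = 1 := hUU
  rw [hinv, Matrix.trace_mul_cycle, hUU', Matrix.one_mul, trace_diagonal]

/-! ## §2. Circle integrals: finite sums and Cauchy's formula for `log` -/

omit [Fintype n] [DecidableEq n] in
/-- Finite sums of circle-integrable functions are circle-integrable. [cite: Balaban1988Convergent, (3.34) p.273] -/
theorem circleIntegrable_finset_sum {ι : Type*} (s : Finset ι) (f : ι → ℂ → ℂ) (c : ℂ) (R : ℝ)
    (hf : ∀ i ∈ s, CircleIntegrable (f i) c R) :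
    CircleIntegrable (fun z => ∑ i ∈ s, f i z) c R := by
  classical
  induction s using Finset.induction_on with
  | empty =>
    simp only [Finset.sum_empty]
    exact (continuousOn_const).circleIntegrable'
  | @insert a s ha ih =>
    have hfa : CircleIntegrable (f a) c R := hf a (Finset.mem_insert_self a s)
    have hfs : ∀ i ∈ s, CircleIntegrable (f i) c R := fun i hi => hf i (Finset.mem_insert_of_mem hi)
    have := hfa.add (ih hfs)
    simpa only [Finset.sum_insert ha, Pi.add_def] using this

omit [Fintype n] [DecidableEq n] in
/-- Finite sums commute with circle integrals (each summand circle-integrable). [cite: Balaban1988Convergent, (3.34) p.273] -/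
theorem circleIntegral_finset_sum {ι : Type*} (s : Finset ι) (f : ι → ℂ → ℂ) (c : ℂ) (R : ℝ)
    (hf : ∀ i ∈ s, CircleIntegrable (f i) c R) :
    (∮ z in C(c, R), ∑ i ∈ s, f i z) = ∑ i ∈ s, ∮ z in C(c, R), f i z := by
  classical
  induction s using Finset.induction_on with
  | empty => simp [circleIntegral]
  | @insert a s ha ih =>
    have hfa : CircleIntegrable (f a) c R := hf a (Finset.mem_insert_self a s)
    have hfs : ∀ i ∈ s, CircleIntegrable (f i) c R := fun i hi => hf i (Finset.mem_insert_of_mem hi)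
    have hsum : CircleIntegrable (fun z => ∑ i ∈ s, f i z) c R := circleIntegrable_finset_sum s f c R hfs
    rw [Finset.sum_insert ha, ← ih hfs, ← circleIntegral.integral_add hfa hsum]
    simp only [Finset.sum_insert ha]

omit [Fintype n] [DecidableEq n] in
/-- The closed disc `|z − c| ≤ R`, `0 < R < c`, lies in the open right half-plane, hence in the slit plane where `log`
is holomorphic. [cite: Balaban1988Convergent, (3.34) p.273] -/
theorem re_pos_of_mem_closedBall {c R : ℝ} (hRc : R < c) {z : ℂ} (hz : z ∈ Metric.closedBall (c : ℂ) R) :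
    0 < z.re := by
  rw [Metric.mem_closedBall, dist_eq_norm] at hz
  have h1 : |(z - c).re| ≤ ‖z - (c : ℂ)‖ := Complex.abs_re_le_norm _
  have h2 : (z - (c : ℂ)).re = z.re - c := by simp
  rw [h2] at h1
  have := (abs_le.mp (h1.trans hz)).1
  linarith

omit [Fintype n] [DecidableEq n] in
/-- **Cauchy's integral formula for `log` on a circle in the right half-plane**: for `0 < R < c` and `μ` in the open
disc, `∮_{C(c,R)} log z · (μ − z)⁻¹ dz = −2πi · log μ` — the scalar case of (3.34)₂.
[cite: Balaban1988Convergent, (3.34) p.273] -/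
theorem circleIntegral_log_mul_inv_sub {c R : ℝ} (hR : 0 < R) (hRc : R < c) {μ : ℂ}
    (hμ : μ ∈ Metric.ball (c : ℂ) R) :
    (∮ z in C((c : ℂ), R), Complex.log z * (μ - z)⁻¹) = -(2 * π * I) * Complex.log μ := by
  have hdiff : DiffContOnCl ℂ Complex.log (Metric.ball (c : ℂ) R) := by
    apply DifferentiableOn.diffContOnCl
    rw [closure_ball (c : ℂ) hR.ne']
    intro z hz
    exact (Complex.differentiableAt_log
      (Complex.mem_slitPlane_iff.mpr (Or.inl (re_pos_of_mem_closedBall hRc hz)))).differentiableWithinAt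
  have hC := hdiff.circleIntegral_sub_inv_smul hμ
  have heq : (fun z => Complex.log z * (μ - z)⁻¹) = fun z => -((z - μ)⁻¹ • Complex.log z) := by
    funext z
    rw [smul_eq_mul, ← neg_sub z μ, inv_neg]
    ring
  rw [heq]
  simp only [circleIntegral, smul_neg, intervalIntegral.integral_neg]
  change -(∮ z in C((c : ℂ), R), (z - μ)⁻¹ • Complex.log z) = _
  rw [hC, smul_eq_mul]
  ring

/-! ## §3. (3.34), second equality -/

/-- Every positive definite `T` admits a circle `C(c, R)`, `0 < R < c`, in the right half-plane containing all its
eigenvalues (take `c` = half the sum of the extreme bounds, …) — "the contour γ surrounds the spectrum of C*Δ^{(k)}C".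
[cite: Balaban1988Convergent, (3.34) p.273] -/
theorem exists_circle {T : Matrix n n ℝ} (hT : T.PosDef) :
    ∃ c R : ℝ, 0 < R ∧ R < c ∧ ∀ i, hT.1.eigenvalues i ∈ Set.Ioo (c - R) (c + R) := by
  have hpos : ∀ i, 0 < hT.1.eigenvalues i := hT.eigenvalues_pos
  -- a lower bound `m > 0` and an upper bound `M` of the spectrum
  obtain ⟨M, hM⟩ : ∃ M : ℝ, ∀ i, hT.1.eigenvalues i < M :=
    ⟨(∑ i, hT.1.eigenvalues i) + 1, fun i => by
      have := Finset.single_le_sum (fun j _ => (hpos j).le) (Finset.mem_univ i)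
      linarith⟩
  by_cases hne : Nonempty n
  · obtain ⟨i₀, -, hi₀⟩ := Finset.exists_min_image Finset.univ (fun i => hT.1.eigenvalues i)
      (Finset.univ_nonempty_iff.mpr hne)
    set m := hT.1.eigenvalues i₀ with hm
    have hm0 : 0 < m := hpos i₀
    have hmM : m < M := hM i₀
    refine ⟨(m / 2 + M) / 2 + m / 4, (M - m / 2) / 2, by linarith, by linarith, fun i => ?_⟩
    have h1 : m ≤ hT.1.eigenvalues i := hi₀ i (Finset.mem_univ i)
    have h2 := hM i
    constructor <;> linarith
  · refine ⟨2, 1, by norm_num, by norm_num, fun i => (hne ⟨i⟩).elim⟩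

/-- **(3.34), second equality** (p. 273 [PDF 31], verbatim in the module docstring): for the positive operator
`T = C*Δ^{(k)}C` (positive definite real symmetric, hypothesis `hT`) and a circle `γ = C(c, R)`, `0 < R < c`, surrounding
its spectrum,
`(1/(4πi)) ∮_γ dz log z · Tr(T − zI)⁻¹ = −½ log det T`
(`Tr(T − zI)⁻¹` = trace of the inverse of the complexified matrix).  PROOF = the printed mechanism: diagonalize,
`Tr(T − zI)⁻¹ = Σ_k (λ_k − z)⁻¹`, and Cauchy's formula eigenvalue by eigenvalue. [cite: Balaban1988Convergent, (3.34) p.273] -/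
theorem eq334_contour {T : Matrix n n ℝ} (hT : T.PosDef) {c R : ℝ} (hR : 0 < R) (hRc : R < c)
    (hin : ∀ i, hT.1.eigenvalues i ∈ Set.Ioo (c - R) (c + R)) :
    (1 / (4 * π * I)) * (∮ z in C((c : ℂ), R),
        Complex.log z * ((T.map (algebraMap ℝ ℂ)) - z • (1 : Matrix n n ℂ))⁻¹.trace) =
      -(1 / 2 : ℂ) * (Real.log T.det : ℂ) := by
  set A : Matrix n n ℂ := T.map (algebraMap ℝ ℂ) with hAdef
  have hA : A.IsHermitian := isHermitian_map_ofReal hT.1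
  set μ : n → ℝ := hA.eigenvalues with hμ
  -- the eigenvalues of the complexification lie in the same interval (transfer through `Σ_k f(μ_k) = Σ_k f(λ_k)`)
  have hμin : ∀ k, μ k ∈ Set.Ioo (c - R) (c + R) := by
    classical
    let f : ℝ → ℝ := fun x => if x ∈ Set.Ioo (c - R) (c + R) then 0 else 1
    have hf0 : ∀ x, 0 ≤ f x := fun x => by simp only [f]; split_ifs <;> norm_num
    have hsum : ∑ k, f (μ k) = ∑ k, f (hT.1.eigenvalues k) := sum_eigenvalues_map_ofReal hT.1 hA f
    have hzero : ∑ k, f (hT.1.eigenvalues k) = 0 :=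
      Finset.sum_eq_zero fun k _ => by simp only [f, hin k, if_true]
    rw [hzero] at hsum
    intro k
    have hk := (Finset.sum_eq_zero_iff_of_nonneg fun j _ => hf0 (μ j)).mp hsum k (Finset.mem_univ k)
    by_contra hnot
    simp only [f, hnot, if_false] at hk
    exact one_ne_zero hk
  have hμball : ∀ k, ((μ k : ℝ) : ℂ) ∈ Metric.ball (c : ℂ) R := by
    intro k
    rw [Metric.mem_ball, dist_eq_norm, ← Complex.ofReal_sub, Complex.norm_real, Real.norm_eq_abs, abs_lt]
    have := hμin k
    constructor <;> linarith [this.1, this.2]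
  have hμpos : ∀ k, 0 < μ k := fun k => by have := (hμin k).1; linarith
  -- on the circle, the integrand is the eigen-sum
  have hsphere : ∀ z ∈ Metric.sphere (c : ℂ) R, ∀ k, ((μ k : ℝ) : ℂ) ≠ z := by
    intro z hz k h
    have hb := hμball k
    rw [h] at hb
    rw [Metric.mem_sphere] at hz
    rw [Metric.mem_ball] at hb
    exact (lt_irrefl _) (hz ▸ hb)
  have hcongr : (∮ z in C((c : ℂ), R), Complex.log z * (A - z • (1 : Matrix n n ℂ))⁻¹.trace) =
      ∮ z in C((c : ℂ), R), ∑ k, Complex.log z * (((μ k : ℝ) : ℂ) - z)⁻¹ := by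
    refine circleIntegral.integral_congr hR.le fun z hz => ?_
    show Complex.log z * (A - z • (1 : Matrix n n ℂ))⁻¹.trace = ∑ k, Complex.log z * (((μ k : ℝ) : ℂ) - z)⁻¹
    rw [trace_inv_sub_smul_one hA z (hsphere z hz), Finset.mul_sum]
  -- each summand is continuous on the circle
  have hcont : ∀ k ∈ (Finset.univ : Finset n),
      CircleIntegrable (fun z => Complex.log z * (((μ k : ℝ) : ℂ) - z)⁻¹) (c : ℂ) R := by
    intro k _
    apply ContinuousOn.circleIntegrable hR.le
    intro z hz
    have hzre : 0 < z.re := re_pos_of_mem_closedBall hRc (Metric.sphere_subset_closedBall hz)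
    have h1 : ContinuousAt Complex.log z :=
      continuousAt_clog (Complex.mem_slitPlane_iff.mpr (Or.inl hzre))
    have h2 : ContinuousAt (fun w => (((μ k : ℝ) : ℂ) - w)⁻¹) z :=
      (continuousAt_const.sub continuousAt_id).inv₀ (sub_ne_zero.mpr (hsphere z hz k))
    exact (h1.mul h2).continuousWithinAt
  rw [hcongr, circleIntegral_finset_sum Finset.univ _ _ _ hcont]
  simp_rw [circleIntegral_log_mul_inv_sub hR hRc (hμball _)]
  -- the scalar logarithms are real
  have hlog : ∀ k, Complex.log ((μ k : ℝ) : ℂ) = ((Real.log (μ k) : ℝ) : ℂ) := fun k =>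
    (Complex.ofReal_log (hμpos k).le).symm
  simp_rw [hlog]
  rw [← Finset.mul_sum, ← Complex.ofReal_sum, sum_eigenvalues_map_ofReal hT.1 hA Real.log,
    ← B10LogDet63.log_det_eq_sum hT]
  have hπ : (4 * (π : ℂ) * I) ≠ 0 := by
    have : (π : ℂ) ≠ 0 := Complex.ofReal_ne_zero.mpr Real.pi_ne_zero
    exact mul_ne_zero (mul_ne_zero (by norm_num) this) Complex.I_ne_zero
  field_simp
  ring

/-- (3.34) as a chain, second and first equalities together: `(1/(4πi)) ∮_γ dz log z · Tr(T − zI)⁻¹ = −½ Tr log T`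
(`log T = cfc Real.log T`, the sibling module's `B14LogDet336Matrix.log_det_eq_trace_log`).
[cite: Balaban1988Convergent, (3.34) p.273] -/
theorem eq334_contour_trace_log {T : Matrix n n ℝ} (hT : T.PosDef) {c R : ℝ} (hR : 0 < R) (hRc : R < c)
    (hin : ∀ i, hT.1.eigenvalues i ∈ Set.Ioo (c - R) (c + R)) :
    (1 / (4 * π * I)) * (∮ z in C((c : ℂ), R),
        Complex.log z * ((T.map (algebraMap ℝ ℂ)) - z • (1 : Matrix n n ℂ))⁻¹.trace) =
      -(1 / 2 : ℂ) * ((Matrix.trace (cfc Real.log T) : ℝ) : ℂ) := by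
  rw [eq334_contour hT hR hRc hin, B14LogDet336Matrix.log_det_eq_trace_log hT]

/-- (3.34)₂ with the contour chosen for the given `T` (some circle in the right half-plane around the spectrum,
`exists_circle`): there is a contour `γ` surrounding the spectrum with
`−½ log det T = (1/(4πi)) ∫_γ dz log z Tr(T − zI)⁻¹`. [cite: Balaban1988Convergent, (3.34) p.273] -/
theorem eq334_second {T : Matrix n n ℝ} (hT : T.PosDef) :
    ∃ c R : ℝ, 0 < R ∧ R < c ∧ (∀ i, hT.1.eigenvalues i ∈ Set.Ioo (c - R) (c + R)) ∧
      -(1 / 2 : ℂ) * (Real.log T.det : ℂ) = (1 / (4 * π * I)) * (∮ z in C((c : ℂ), R),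
        Complex.log z * ((T.map (algebraMap ℝ ℂ)) - z • (1 : Matrix n n ℂ))⁻¹.trace) := by
  obtain ⟨c, R, hR, hRc, hin⟩ := exists_circle hT
  exact ⟨c, R, hR, hRc, hin, (eq334_contour hT hR hRc hin).symm⟩

end Literature.MathematicalPhysics.QuantumFieldTheory.Balaban1983to89.B14.Eq334Contour
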